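import Summits.SmoothPoincare4.SmoothPoincare4.Theorems.ConvexBisectionAcyclicBisectionExistsBeltSlideRotation
import Literature.Topology.FourManifolds.HandleAttachingMapsShrink
import Literature.Topology.FourManifolds.CircleNbhdTransport
import HarnessLib

/-!
# Sliding the belt circle inside the handle, II: the slid tube `G_{r,t} = R_{φ_r(t)} ∘ σ ∘ ρ : T → D⁴ ∖ S`
(node T3c-1 `node_belt_isotopic_pushoff` of the sub-goal T3 "the complement piece is the cap with the
DUAL handles" of stub `stub_steinRealisation` (NF6), line `modp-braid-orbits`, crux
`ConvexBisection.AcyclicBisectionExists`, item stmt-SmoothPoincare4-10508; wave 2, worker V6, lead c5)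

Sequel of `…BeltSlideRotation.lean` (`slideIso b φ`, `slideAngle r t`).  The belt map of a handle
is `D.jB ∘ σ : T → P` (`…DualHandleBeltMap.lean`, `σ` the block swap).  To move its attaching circle
(the belt circle) by the rotations `R_{φ_r(t)}` while keeping an attaching map DEFINED ON ALL OF `T`
at every time, the tube is first squeezed towards its core by the shrink `ρ = ρ_{1/8}` of
`HandleAttachingMapsShrink.lean` (the identity on `{|x_λ|² > 7/8}`, image in `{|x_λ|² > 3/4}`), so
that `R_{φ_r(t)} (σ (ρ T))` stays in the handle `D⁴ ∖ S` (`lamSq_slideFun_lt_one`):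

* §3 `tubeRho` (`= HandleShrink.rho 3 2`, `ε = 1/8`) and its API; `slideBallPt`,
  **`slideInner b r t : T → D⁴ ∖ S`**, `y ↦ R_{φ_r(t)} (σ (ρ y))`: preserves `∂D⁴`
  (`norm_slideInner_eq_one_iff`), a smooth embedding (`isSmoothEmbedding_slideInner`: shrink, swap,
  inclusion, isometry, corestriction) with open range (`isOpen_range_slideInner`), JOINTLY smooth in
  `(t, y)` (`contMDiff_slideInner_uncurry`, tested in `ℝ⁴` via `slideAmb`, `codRestrict_closedBall`),
  equal to `R_{φ_r(t)} ∘ σ` near the attaching sphere (`coe_coe_slideInner_of_lt`) and to `σ ∘ ρ`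
  for `t ≤ 0` (`slideInner_of_nonpos`);
* §4 registered helper `helper_belt_slideTube`.

Everything is proved; no named facts.

## References
* A. A. Kosinski, *Differential Manifolds*, Academic Press (1993), VI §6, (6.1). [Kosinski1993]
* J. Milnor, *Lectures on the h-cobordism theorem* (1965), §3 (dual handles). [MilnorHCobordism1965]
* R. C. Kirby, *The Topology of 4-Manifolds*, LNM 1374 (1989), Ch. I §2 (framings). [Kirby1989]
* R. E. Gompf, A. I. Stipsicz, *4-Manifolds and Kirby Calculus* (1999), §8.2. [GompfStipsicz1999]
-/

noncomputable section

-- the prescribed namespace `Summit.<P>.<Sub>.…` duplicates `SmoothPoincare4` (P = Sub)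
set_option linter.dupNamespace false

open scoped Manifold ContDiff Topology
open Set Function Metric Real

namespace Summit.SmoothPoincare4.SmoothPoincare4.Theorems.AcyclicBisectionExists.ModpBraidOrbits

open Literature.Topology.FourManifolds Literature.Topology.FourManifolds.HandleAttachingMap

/-! ### §3 The slid tube `G_{r,t} = R_{φ_r(t)} ∘ σ ∘ ρ : T → D⁴ ∖ S` -/

/-- Kosinski's tube is non-empty. [folklore] -/
instance nonempty_handleTube : Nonempty ↥(handleTube 3 2) := ⟨tubeBasePt⟩

/-- The shrink `ρ = ρ_{1/8} : T ⇀ T` of `HandleAttachingMapsShrink.lean` (the identity on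
`{|x_λ|² > 7/8}`, squeezing `T` into `{|x_λ|² > 3/4}`). [cite: Kosinski1993, VI §6] -/
def tubeRho : OpenPartialHomeomorph ↥(handleTube 3 2) ↥(handleTube 3 2) :=
  HandleShrink.rho 3 2 (ε := 1 / 8) (by norm_num) (by norm_num)

/-- The shrink has source `T`. [folklore] -/
theorem tubeRho_source : tubeRho.source = univ := HandleShrink.rho_source 3 2 _ _

/-- The shrink is the identity near the attaching sphere: on `{|x_λ|² > 7/8}`. [folklore] -/
theorem tubeRho_eq_self {y : ↥(handleTube 3 2)}
    (hy : 7 / 8 < lamSq 2 (((y : closedBall (0 : EuclideanSpace ℝ (Fin 4)) 1) : EuclideanSpace ℝ (Fin 4)))) :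
    tubeRho y = y := by
  rw [tubeRho, HandleShrink.rho_apply]
  exact HandleShrink.rhoFun_eq_self_of_lt 3 2 _ _ (by linarith)

/-- The shrunken tube is thin: `|ρ(y)_λ|² > 3/4`. [folklore] -/
theorem lt_lamSq_tubeRho (y : ↥(handleTube 3 2)) :
    3 / 4 < lamSq 2 (((tubeRho y : ↥(handleTube 3 2)) : closedBall (0 : EuclideanSpace ℝ (Fin 4)) 1) :
      EuclideanSpace ℝ (Fin 4)) := by
  rw [tubeRho, HandleShrink.rho_apply]
  have h1 := HandleShrink.lt_lamSq_rhoFun 3 2 (ε := 1 / 8) (by norm_num) (by norm_num) y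
  have h2 := HandleShrink.sigma_one_lt (ε := 1 / 8) (by norm_num)
  linarith

/-- The shrink preserves `∂D⁴`. [folklore] -/
theorem norm_tubeRho_eq_one_iff (y : ↥(handleTube 3 2)) :
    ‖(((tubeRho y : ↥(handleTube 3 2)) : closedBall (0 : EuclideanSpace ℝ (Fin 4)) 1) :
      EuclideanSpace ℝ (Fin 4))‖ = 1 ↔
      ‖((y : closedBall (0 : EuclideanSpace ℝ (Fin 4)) 1) : EuclideanSpace ℝ (Fin 4))‖ = 1 :=
  HandleShrink.norm_rho_eq_one_iff 3 2 _ _ y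

/-- The shrink is smooth. [folklore] -/
theorem contMDiff_tubeRho : ContMDiff (𝓡∂ 4) (𝓡∂ 4) ∞ tubeRho := by
  have h := HandleShrink.contMDiffOn_rho 3 2 (ε := 1 / 8) (by norm_num) (by norm_num)
  rw [HandleShrink.rho_source] at h
  exact contMDiffOn_univ.1 h

/-- **The ball point `R_{φ_r(t)} (σ (ρ y))` of the slid tube.** [folklore] -/
def slideBallPt (b : Bool) (r t : ℝ) (y : ↥(handleTube 3 2)) : closedBall (0 : EuclideanSpace ℝ (Fin 4)) 1 :=
  closedBallCongr (slideIso b (slideAngle r t))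
    ((swapTube (tubeRho y) : ↥(beltPiece 3 2)) : closedBall (0 : EuclideanSpace ℝ (Fin 4)) 1)

/-- Its vector: `R_{φ_r(t)} (σ (ρ y))`. [folklore] -/
theorem coe_slideBallPt (b : Bool) (r t : ℝ) (y : ↥(handleTube 3 2)) :
    ((slideBallPt b r t y : closedBall (0 : EuclideanSpace ℝ (Fin 4)) 1) : EuclideanSpace ℝ (Fin 4)) =
      slideFun b (slideAngle r t) (swapIso (((tubeRho y : ↥(handleTube 3 2)) :
        closedBall (0 : EuclideanSpace ℝ (Fin 4)) 1) : EuclideanSpace ℝ (Fin 4))) := by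
  rw [slideBallPt, coe_closedBallCongr, slideIso_apply, coe_coe_swapTube]

/-- **The slid tube stays in the handle `D⁴ ∖ S`**: `|R_{φ_r(t)} (σ (ρ y))_λ|² < 1`. [folklore] -/
theorem lamSq_slideBallPt_lt_one (b : Bool) (r t : ℝ) (y : ↥(handleTube 3 2)) :
    lamSq 2 ((slideBallPt b r t y : closedBall (0 : EuclideanSpace ℝ (Fin 4)) 1) : EuclideanSpace ℝ (Fin 4)) < 1 := by
  rw [coe_slideBallPt]
  refine lamSq_slideFun_lt_one b (sin_slideAngle_nonneg r t) (sin_slideAngle_le_half r t)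
    (cos_slideAngle_pos r t).le ?_ ?_
  · rw [norm_swapIso]; exact mem_closedBall_zero_iff.1 (tubeRho y).1.2
  · rw [muSq_swapIso]; exact lt_lamSq_tubeRho y

/-- **The slid tube map `G_{r,t} : T → D⁴ ∖ S`, `y ↦ R_{φ_r(t)} (σ (ρ y))`.** [folklore] -/
def slideInner (b : Bool) (r t : ℝ) (y : ↥(handleTube 3 2)) : ↥(beltPiece 3 2) :=
  ⟨slideBallPt b r t y, by
    rw [mem_beltPiece]; exact (lamSq_slideBallPt_lt_one b r t y).ne⟩

/-- The underlying ball point of `slideInner`. [folklore] -/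
@[simp] theorem coe_slideInner (b : Bool) (r t : ℝ) (y : ↥(handleTube 3 2)) :
    ((slideInner b r t y : ↥(beltPiece 3 2)) : closedBall (0 : EuclideanSpace ℝ (Fin 4)) 1) =
      slideBallPt b r t y := rfl

/-- `G_{r,t}` preserves `∂D⁴`. [folklore] -/
theorem norm_slideInner_eq_one_iff (b : Bool) (r t : ℝ) (y : ↥(handleTube 3 2)) :
    ‖(((slideInner b r t y : ↥(beltPiece 3 2)) : closedBall (0 : EuclideanSpace ℝ (Fin 4)) 1) :
      EuclideanSpace ℝ (Fin 4))‖ = 1 ↔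
      ‖((y : closedBall (0 : EuclideanSpace ℝ (Fin 4)) 1) : EuclideanSpace ℝ (Fin 4))‖ = 1 := by
  rw [coe_slideInner, coe_slideBallPt, norm_slideFun, norm_swapIso, norm_tubeRho_eq_one_iff]

/-- **`G_{r,t}` is a smooth embedding** (shrink, swap, the inclusion `D⁴ ∖ S ⊆ D⁴`, the isometry,
corestricted to the open `D⁴ ∖ S`). [folklore] -/
theorem isSmoothEmbedding_slideInner (b : Bool) (r t : ℝ) :
    Manifold.IsSmoothEmbedding (𝓡∂ 4) (𝓡∂ 4) ∞ (slideInner b r t) := by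
  have h1 : Manifold.IsSmoothEmbedding (𝓡∂ 4) (𝓡∂ 4) ∞ (swapTube ∘ tubeRho) :=
    isSmoothEmbedding_swapTube.comp_openPartialHomeomorph tubeRho tubeRho_source
      (HandleShrink.contMDiffOn_rho 3 2 _ _) (HandleShrink.contMDiffOn_rho_symm 3 2 _ _)
  have h2 := (Manifold.IsSmoothEmbedding.subtypeVal_comp (beltPiece 3 2) h1).diffeomorph_comp
    (closedBallCongr (slideIso b (slideAngle r t)))
  exact h2.codRestrict_opens (beltPiece 3 2) fun y => (slideInner b r t y).2

/-- **`G_{r,t}` has open range.** [folklore] -/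
theorem isOpen_range_slideInner (b : Bool) (r t : ℝ) : IsOpen (range (slideInner b r t)) := by
  have ho1 : IsOpen (range (swapTube ∘ tubeRho)) := by
    rw [range_comp]
    refine isOpenEmbedding_swapTube.isOpenMap _ ?_
    have e : range tubeRho = tubeRho.target := by
      rw [← image_univ, ← tubeRho_source, tubeRho.image_source_eq_target]
    rw [e]; exact tubeRho.open_target
  have ho2 : IsOpen (range (Subtype.val ∘ (swapTube ∘ tubeRho) :
      ↥(handleTube 3 2) → closedBall (0 : EuclideanSpace ℝ (Fin 4)) 1)) := by
    rw [range_comp]; exact (beltPiece 3 2).isOpenEmbedding'.isOpenMap _ ho1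
  have ho3 : IsOpen (range (slideBallPt b r t)) := by
    have : range (slideBallPt b r t) = closedBallCongr (slideIso b (slideAngle r t)) ''
        range (Subtype.val ∘ (swapTube ∘ tubeRho)) := by
      rw [← range_comp]; rfl
    rw [this]
    exact (closedBallCongr (slideIso b (slideAngle r t))).toHomeomorph.isOpenMap _ ho2
  have e : range (slideInner b r t) = Subtype.val ⁻¹' range (slideBallPt b r t) := by
    ext z
    constructor
    · rintro ⟨y, rfl⟩; exact ⟨y, rfl⟩
    · rintro ⟨y, hy⟩; exact ⟨y, Subtype.ext hy⟩
  rw [e]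
  exact ho3.preimage continuous_subtype_val

/-- The ambient expression `(t, y) ↦ R_{φ_r(t)} (σ (ρ y)) ∈ ℝ⁴` of the slid tube. [folklore] -/
def slideAmb (b : Bool) (r : ℝ) (p : ℝ × ↥(handleTube 3 2)) : EuclideanSpace ℝ (Fin 4) :=
  slideFun b (slideAngle r p.1) (swapIso (((tubeRho p.2 : ↥(handleTube 3 2)) :
    closedBall (0 : EuclideanSpace ℝ (Fin 4)) 1) : EuclideanSpace ℝ (Fin 4)))

/-- The ambient expression is jointly smooth (the angle in `t`, `R_φ v` in `(φ, v)`, `σ (ρ y)` in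
`y`). [folklore] -/
theorem contMDiff_slideAmb (b : Bool) (r : ℝ) :
    ContMDiff (𝓘(ℝ, ℝ).prod (𝓡∂ 4)) 𝓘(ℝ, EuclideanSpace ℝ (Fin 4)) ∞ (slideAmb b r) := by
  have h1 : ContMDiff (𝓡∂ 4) 𝓘(ℝ, EuclideanSpace ℝ (Fin 4)) ∞ fun y : ↥(handleTube 3 2) =>
      (((tubeRho y : ↥(handleTube 3 2)) : closedBall (0 : EuclideanSpace ℝ (Fin 4)) 1) :
        EuclideanSpace ℝ (Fin 4)) :=
    ((contMDiff_coe_closedBall (n := 3)).comp contMDiff_subtype_val).comp contMDiff_tubeRho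
  have hv : ContMDiff (𝓡∂ 4) 𝓘(ℝ, EuclideanSpace ℝ (Fin 4)) ∞ fun y : ↥(handleTube 3 2) =>
      swapIso (((tubeRho y : ↥(handleTube 3 2)) : closedBall (0 : EuclideanSpace ℝ (Fin 4)) 1) :
        EuclideanSpace ℝ (Fin 4)) :=
    (swapIso.toContinuousLinearEquiv.contDiff (n := ∞)).contMDiff.comp h1
  have hpair : ContMDiff (𝓘(ℝ, ℝ).prod (𝓡∂ 4)) 𝓘(ℝ, ℝ × EuclideanSpace ℝ (Fin 4)) ∞
      fun p : ℝ × ↥(handleTube 3 2) => (slideAngle r p.1,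
        swapIso (((tubeRho p.2 : ↥(handleTube 3 2)) : closedBall (0 : EuclideanSpace ℝ (Fin 4)) 1) :
          EuclideanSpace ℝ (Fin 4))) :=
    (((contDiff_slideAngle r).contMDiff).comp contMDiff_fst).prodMk_space (hv.comp contMDiff_snd)
  have h := (contDiff_slideFun_uncurry b).contMDiff.comp hpair
  exact h.congr fun p => rfl

/-- The ambient expression lands in the closed ball. [folklore] -/
theorem slideAmb_mem (b : Bool) (r : ℝ) (p : ℝ × ↥(handleTube 3 2)) :
    slideAmb b r p ∈ closedBall (0 : EuclideanSpace ℝ (Fin 4)) 1 := by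
  have h := (slideBallPt b r p.1 p.2).2
  rwa [coe_slideBallPt] at h

/-- The slid tube, read in `D⁴`, is the corestriction of the ambient expression. [folklore] -/
theorem val_comp_slideInner (b : Bool) (r : ℝ) :
    (Subtype.val ∘ fun p : ℝ × ↥(handleTube 3 2) => slideInner b r p.1 p.2) =
      Set.codRestrict (slideAmb b r) _ (slideAmb_mem b r) := by
  funext p
  apply Subtype.ext
  exact coe_slideBallPt b r p.1 p.2

/-- **The slid tube is jointly smooth in `(t, y)`** (test in `ℝ⁴`, `codRestrict_closedBall`, then
the corestriction to the open `D⁴ ∖ S`). [folklore] -/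
theorem contMDiff_slideInner_uncurry (b : Bool) (r : ℝ) :
    ContMDiff (𝓘(ℝ, ℝ).prod (𝓡∂ 4)) (𝓡∂ 4) ∞
      fun p : ℝ × ↥(handleTube 3 2) => slideInner b r p.1 p.2 := by
  have hB := (contMDiff_slideAmb b r).codRestrict_closedBall (n := 3) (slideAmb_mem b r)
  rw [← val_comp_slideInner] at hB
  exact fun p => (ContMDiffAt.subtypeVal_comp_iff (beltPiece 3 2) _ p).1 (hB p)

/-- Each stage `G_{r,t}` is smooth. [folklore] -/
theorem contMDiff_slideInner (b : Bool) (r t : ℝ) : ContMDiff (𝓡∂ 4) (𝓡∂ 4) ∞ (slideInner b r t) := by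
  have h := (contMDiff_slideInner_uncurry b r).comp
    ((contMDiff_const (c := t)).prodMk (contMDiff_id (I := 𝓡∂ 4) (M := ↥(handleTube 3 2)) (n := ∞)))
  exact h.congr fun y => rfl

/-- **Near the attaching sphere the shrink disappears**: for `|y_λ|² > 7/8`,
`G_{r,t} y = R_{φ_r(t)} (σ y)`. [folklore] -/
theorem coe_coe_slideInner_of_lt (b : Bool) (r t : ℝ) {y : ↥(handleTube 3 2)}
    (hy : 7 / 8 < lamSq 2 (((y : closedBall (0 : EuclideanSpace ℝ (Fin 4)) 1) : EuclideanSpace ℝ (Fin 4)))) :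
    (((slideInner b r t y : ↥(beltPiece 3 2)) : closedBall (0 : EuclideanSpace ℝ (Fin 4)) 1) :
      EuclideanSpace ℝ (Fin 4)) =
      slideFun b (slideAngle r t) (swapIso ((y : closedBall (0 : EuclideanSpace ℝ (Fin 4)) 1) :
        EuclideanSpace ℝ (Fin 4))) := by
  rw [coe_slideInner, coe_slideBallPt, tubeRho_eq_self hy]

/-- Before the slide starts (`t ≤ 0`) the slid tube is the shrunken belt tube `σ ∘ ρ`. [folklore] -/
theorem slideInner_of_nonpos (b : Bool) (r : ℝ) {t : ℝ} (ht : t ≤ 0) (y : ↥(handleTube 3 2)) :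
    slideInner b r t y = swapTube (tubeRho y) := by
  apply Subtype.ext; apply Subtype.ext
  rw [coe_slideInner, coe_slideBallPt, slideAngle_of_nonpos r ht, slideFun_zero, coe_coe_swapTube]



/-! ### §4 Registered helper -/

/-- **Registered helper `helper_belt_slideTube` (stage 1b of node T3c-1 of NF6 `stub_steinRealisation`,
wave 2, lead c5): the slid tube.**  For a direction flag `b` and a radius `r` there is a family
`G t : T → D⁴ ∖ S` (namely `slideInner b r t = R_{φ_r(t)} ∘ σ ∘ ρ`), jointly smooth in `(t, y)`,
each stage a smooth embedding with open range preserving `∂D⁴`, equal to the swap `σ` near the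
attaching sphere for `t ≤ 0`. [cite: Kosinski1993, VI §6] -/
theorem helper_belt_slideTube :
    ∀ (b : Bool) (r : ℝ), ∃ G : ℝ → ↥(Literature.Topology.FourManifolds.handleTube 3 2) →
        ↥(Literature.Topology.FourManifolds.beltPiece 3 2),
      ContMDiff (𝓘(ℝ, ℝ).prod (𝓡∂ 4)) (𝓡∂ 4) ∞
        (fun p : ℝ × ↥(Literature.Topology.FourManifolds.handleTube 3 2) => G p.1 p.2) ∧
      (∀ t, Manifold.IsSmoothEmbedding (𝓡∂ 4) (𝓡∂ 4) ∞ (G t) ∧ IsOpen (Set.range (G t))) ∧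
      (∀ t (y : ↥(Literature.Topology.FourManifolds.handleTube 3 2)),
        ‖(((G t y : ↥(Literature.Topology.FourManifolds.beltPiece 3 2)) :
          Metric.closedBall (0 : EuclideanSpace ℝ (Fin 4)) 1) : EuclideanSpace ℝ (Fin 4))‖ = 1 ↔
        ‖((y : Metric.closedBall (0 : EuclideanSpace ℝ (Fin 4)) 1) : EuclideanSpace ℝ (Fin 4))‖ = 1) ∧
      (∀ t ≤ (0 : ℝ), ∀ y : ↥(Literature.Topology.FourManifolds.handleTube 3 2),
        7 / 8 < Literature.Topology.FourManifolds.lamSq 2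
          ((y : Metric.closedBall (0 : EuclideanSpace ℝ (Fin 4)) 1) : EuclideanSpace ℝ (Fin 4)) →
        (((G t y : ↥(Literature.Topology.FourManifolds.beltPiece 3 2)) :
          Metric.closedBall (0 : EuclideanSpace ℝ (Fin 4)) 1) : EuclideanSpace ℝ (Fin 4)) =
          WithLp.toLp 2 ![((y : Metric.closedBall (0 : EuclideanSpace ℝ (Fin 4)) 1) : EuclideanSpace ℝ (Fin 4)) 2,
            ((y : Metric.closedBall (0 : EuclideanSpace ℝ (Fin 4)) 1) : EuclideanSpace ℝ (Fin 4)) 3,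
            ((y : Metric.closedBall (0 : EuclideanSpace ℝ (Fin 4)) 1) : EuclideanSpace ℝ (Fin 4)) 0,
            ((y : Metric.closedBall (0 : EuclideanSpace ℝ (Fin 4)) 1) : EuclideanSpace ℝ (Fin 4)) 1]) := by
  intro b r
  refine ⟨slideInner b r, contMDiff_slideInner_uncurry b r,
    fun t => ⟨isSmoothEmbedding_slideInner b r t, isOpen_range_slideInner b r t⟩,
    fun t y => norm_slideInner_eq_one_iff b r t y, fun t ht y hy => ?_⟩
  rw [coe_coe_slideInner_of_lt b r t hy, slideAngle_of_nonpos r ht, slideFun_zero]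
  ext j
  fin_cases j <;> simp

end Summit.SmoothPoincare4.SmoothPoincare4.Theorems.AcyclicBisectionExists.ModpBraidOrbits

end
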